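import Summits.BirchSwinnertonDyer.BirchSwinnertonDyer.Theorems.ThetaPartnerAtTwoSignedKatoUpToAtTwoMultiplierAvoidanceAtTwo
import Literature.NumberTheory.EllipticCurves.Kato2004.AdmissibleZetaClass
import HarnessLib

/-!
# Route `ThetaPartnerAtTwo` (TP2), crux K3 `SignedKatoDivisibilityUpToAtTwo` (item stmt-BirchSwinnertonDyer-20308) /
# K3P′ (stmt-BirchSwinnertonDyer-25631), line `colemanrat` v12 — brick MULT-AVOID, §5: READY-TO-USE AUXILIARY DATA for Kato's
# `(c, d, a(A))`-elements at `p = 2` in the tree's `Kato2004.katoMultiplier` vocabulary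

Width seat `bsd-wall-tp2-p2x-w5` g0 (cell `bsd-wall`). HONEST FRAMING: theorems only (no definition, no named fact, no instance,
no `sorry`); closes no item; K3 / K3P′ are NOT settled and BSD is NOT proved by any of this.

## What is here

Packaging of `MultAvoid.exists_fourTerm_not_mem` (`…MultiplierAvoidanceAtTwo`) for the K3 assembly:
* `exists_int_eq_mul_ratMinusSymbol` — an integral normalisation `n(a) = D·[a/A]⁻_f`, `D ∈ ℕ⁺` (product of denominators);
* `exists_int_five_mod_two_pow_coprime` — for odd `N`: an integer `d ≡ 5 (mod 2^m)` with `gcd(d, 12N) = 1` and an inverse `d′` of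
  `d` mod `2^m` (Chinese remainder; these are Kato's guards `(d, 6pN) = 1`, `dd′ ≡ 1 (mod A)` of Ex. 13.3 / Thm. 6.6 (1) at `p = 2`);
* `exists_katoMultiplier_not_mem` — the avoidance theorem restated with `Kato2004.katoMultiplier 2 c d n₁ n₂ n₃ n₄ Ψ_c Ψ_d ∅ …`
  (`E = prime(A) ∖ {p} = ∅` for `A = 2^{k+3}`: the tame Euler product is empty);
* `exists_kato_auxiliaryData_two` — **one-stop form**: from `IsNewformOf W f`, `2 ∤ N` get `k, d, d′, D, n` with ALL of Kato's guards
  for `(c, d, a, A) = (5, d, a, 2^{k+3})` (`Int.gcd 5 (6·2·A) = 1`, `Int.gcd d (6·2·N) = 1`, `d d′ ≡ 1 [ZMOD A]`, `0 < A`) and, for every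
  prime `𝔭 ∌ 2` of `Λ` and all `Ψ_c, Ψ_d ∈ Λ`, a cusp `a` whose multiplier
  `katoMultiplier 2 5 d (n a) (n (5a)) (n (a d′)) (n (5 a d′)) Ψ_c Ψ_d ∅ …` is NOT in `𝔭`.

References: [Kato2004Asterisque] Ex. 13.3 (p. 225), Thm. 6.6 (1) (p. 163), Lemma 13.10–13.11 (pp. 230–231), §13.13–13.14;
[RohrlichInventiones1984] Theorem (p. 409).
-/

set_option autoImplicit false
-- the Theorems namespace of this sub repeats the summit name by design (D-0017 nested layout)
set_option linter.dupNamespace false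

noncomputable section

open scoped Classical

open Finset Literature.NumberTheory.EllipticCurves Literature.NumberTheory.EllipticCurves.ModularForms
  Literature.NumberTheory.EllipticCurves.Kato2004

namespace Summit.BirchSwinnertonDyer.BirchSwinnertonDyer.Theorems.SignedKatoOffTwo.MultAvoid

/-! ## §5 Auxiliary data -/

section Data

/-- **Integral normalisation of the minus symbols of a fixed denominator**: for every `A ≥ 1` there are a positive integer `D`
(the product of the denominators) and integers `n(a)`, `a ∈ ℤ/A`, with `n(a) = D·[a/A]⁻_f`. [folklore] -/
theorem exists_int_eq_mul_ratMinusSymbol {N : ℕ} (f : CuspForm (CongruenceSubgroup.Gamma0 N) 2) (A : ℕ) [NeZero A] :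
    ∃ (D : ℚ) (n : ZMod A → ℤ), D ≠ 0 ∧ ∀ a : ZMod A, (n a : ℚ) = D * ratMinusSymbol f ((a.val : ℚ) / (A : ℚ)) := by
  set r : ZMod A → ℚ := fun a ↦ ratMinusSymbol f ((a.val : ℚ) / (A : ℚ)) with hr
  refine ⟨((∏ b : ZMod A, (r b).den : ℕ) : ℚ),
    fun a ↦ (((∏ b : ZMod A, (r b).den) / (r a).den : ℕ) : ℤ) * (r a).num, ?_, fun a ↦ ?_⟩
  · exact Nat.cast_ne_zero.mpr (Finset.prod_pos fun b _ ↦ (r b).den_pos).ne'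
  · obtain ⟨q, hq⟩ : (r a).den ∣ ∏ b : ZMod A, (r b).den := Finset.dvd_prod_of_mem _ (Finset.mem_univ a)
    rw [hq]
    dsimp only
    rw [Nat.mul_div_cancel_left _ (r a).den_pos]
    have hra : ratMinusSymbol f ((a.val : ℚ) / (A : ℚ)) = ((r a).num : ℚ) / ((r a).den : ℚ) :=
      (Rat.num_div_den (r a)).symm
    rw [hra]
    have hden' : ((r a).den : ℚ) ≠ 0 := Nat.cast_ne_zero.mpr (r a).den_pos.ne'
    push_cast
    field_simp

/-- **Kato's guards at `p = 2` for `d ≡ 5 (mod 2^m)`**: for odd `N` and `m ≥ 1` there are integers `d, d′` with `d ≡ 5 (mod 2^m)`,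
`gcd(d, 6·2·N) = 1` (Ex. 13.3: `(d, 6pN) = 1`) and `d d′ ≡ 1 (mod 2^m)` — Chinese remainder with `d ≡ 1 (mod 3N)`.
[cite: Kato2004Asterisque, Ex. 13.3 (p. 225)] -/
theorem exists_int_five_mod_two_pow_coprime {N : ℕ} (hN : ¬ 2 ∣ N) {m : ℕ} (hm : 1 ≤ m) :
    ∃ d d' : ℤ, (d : ZMod (2 ^ m)) = 5 ∧ Int.gcd d (6 * 2 * N) = 1 ∧ d * d' ≡ 1 [ZMOD ((2 ^ m : ℕ) : ℤ)] ∧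
      (d : ZMod (2 ^ m)) * (d' : ZMod (2 ^ m)) = 1 := by
  have hco : Nat.Coprime (2 ^ m) (3 * N) := by
    refine Nat.Coprime.pow_left m ?_
    rw [Nat.coprime_mul_iff_right]
    exact ⟨by norm_num, Nat.coprime_two_left.mpr (Nat.odd_iff.mpr (Nat.two_dvd_ne_zero.mp hN))⟩
  obtain ⟨x, hx5, hx1⟩ := Nat.chineseRemainder hco 5 1
  -- `x` is odd and `≡ 1 (mod 3N)`, hence prime to `12 N`
  have hx2 : Nat.Coprime x 2 := by
    have h2m : 2 ∣ 2 ^ m := dvd_pow_self 2 (by omega)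
    have hx5' : x ≡ 5 [MOD 2] := Nat.ModEq.of_dvd h2m hx5
    rw [Nat.coprime_two_right, Nat.odd_iff]
    exact hx5'
  have hx3N : Nat.Coprime x (3 * N) := by
    rw [Nat.coprime_iff_gcd_eq_one, hx1.gcd_eq, Nat.gcd_one_left]
  have hx12N : Nat.Coprime x (6 * 2 * N) := by
    have : 6 * 2 * N = 2 ^ 2 * (3 * N) := by ring
    rw [this]
    exact Nat.Coprime.mul_right (hx2.pow_right 2) hx3N
  have hx2m : Nat.Coprime x (2 ^ m) := hx2.pow_right m
  obtain ⟨y, hy⟩ := Int.mod_coprime hx2m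
  refine ⟨x, y, ?_, ?_, hy, ?_⟩
  · have h := (ZMod.natCast_eq_natCast_iff x 5 (2 ^ m)).mpr hx5
    rw [Int.cast_natCast, h, Nat.cast_ofNat]
  · rw [show (6 * 2 * (N : ℤ)) = ((6 * 2 * N : ℕ) : ℤ) by push_cast; ring, Int.gcd_natCast_natCast]
    exact hx12N
  · rw [← Int.cast_mul, ← Int.cast_one (R := ZMod (2 ^ m)), ZMod.intCast_eq_intCast_iff]
    exact hy

variable {N : ℕ} [NeZero N] {W : WeierstrassCurve ℚ} [W.IsElliptic] {f : CuspForm (CongruenceSubgroup.Gamma0 N) 2}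

/-- **The avoidance theorem in `katoMultiplier` vocabulary** (`E = prime(A) ∖ {p} = ∅` for `A = 2^{k+3}`): with `k, 𝔭, c, d, d′, D, n`
as in `exists_fourTerm_not_mem` and ANY `Ψ_c, Ψ_d ∈ Λ` (and any tame data, unused since `E = ∅`), some cusp `a` has
`Kato2004.katoMultiplier 2 c d (n a) (n (ac)) (n (ad′)) (n (acd′)) Ψ_c Ψ_d ∅ … ∉ 𝔭`.
[cite: Kato2004Asterisque, Lemma 13.10–13.11 (pp. 230–231), §13.13–13.14 (pp. 232–234)] -/
theorem exists_katoMultiplier_not_mem (hfW : IsNewformOf W f) (h2N : ¬ 2 ∣ N) :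
    ∃ k : ℕ, ∀ (𝔭 : PrimeSpectrum (IwasawaAlgebra 2)), PowerSeries.C (2 : ℤ_[2]) ∉ 𝔭.asIdeal →
      ∀ (c d d' : ℤ), (c : ZMod (2 ^ (k + 3))) = 5 → (d : ZMod (2 ^ (k + 3))) = 5 →
        (d : ZMod (2 ^ (k + 3))) * (d' : ZMod (2 ^ (k + 3))) = 1 →
      ∀ (D : ℚ), D ≠ 0 → ∀ (n : ZMod (2 ^ (k + 3)) → ℤ),
        (∀ a : ZMod (2 ^ (k + 3)), (n a : ℚ) = D * ratMinusSymbol f ((a.val : ℚ) / ((2 ^ (k + 3) : ℕ) : ℚ))) →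
      ∀ (Ψc Ψd : IwasawaAlgebra 2) (aℓ εℓ : ℕ → ℤ) (Ψℓ : ℕ → IwasawaAlgebra 2), ∃ a : ZMod (2 ^ (k + 3)),
        katoMultiplier 2 c d (n a) (n (a * c)) (n (a * d')) (n (a * c * d')) Ψc Ψd ∅ aℓ εℓ Ψℓ ∉ 𝔭.asIdeal := by
  obtain ⟨k, hk⟩ := exists_fourTerm_not_mem hfW h2N
  refine ⟨k, fun 𝔭 h2 c d d' hc hd hdd' D hD n hn Ψc Ψd aℓ εℓ Ψℓ ↦ ?_⟩
  obtain ⟨a, ha⟩ := hk 𝔭 h2 c d d' hc hd hdd' D hD n hn Ψc Ψd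
  refine ⟨a, ?_⟩
  rw [katoMultiplier, Finset.prod_empty, mul_one]
  exact ha

/-- **One-stop auxiliary data for Kato's `(5, d, a(2^{k+3}))`-elements at `p = 2`.** For the newform `f` of an elliptic curve `W/ℚ` of
odd level `N`: there are `k`, integers `d, d′`, a rational `D ≠ 0` and integers `n(a) = D·[a/2^{k+3}]⁻_f` such that ALL of Kato's
guards hold for `(c, d, a, A) = (5, d, a, 2^{k+3})` — `0 < A`, `Int.gcd 5 (6·2·A) = 1`, `Int.gcd d (6·2·N) = 1` (Ex. 13.3 as typed in
`Kato2004.exists_eulerSystem_expStar_values`), `d d′ ≡ 1 [ZMOD A]` and `Int.gcd (5·d) (2^j · A) = 1` for all `j` (value law (C5)) — and for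
EVERY prime `𝔭` of `Λ = ℤ₂⟦T⟧` with `2 ∉ 𝔭` and ALL `Ψ_c, Ψ_d ∈ Λ` (any tame data), some cusp `a ∈ ℤ/2^{k+3}` has
`katoMultiplier 2 5 d (n a) (n (5a)) (n (a d′)) (n (5 a d′)) Ψ_c Ψ_d ∅ … ∉ 𝔭`. This is the per-prime choice of auxiliary data of
Kato §13.13–13.14 at `p = 2`, ready for the K3 assembly (the class is chosen AFTER `𝔭`; the multiplier `μ` of (ERL_χ) is this
element up to `2`-powers and units). [cite: Kato2004Asterisque, Ex. 13.3 (p. 225), Thm. 6.6 (1) (p. 163), §13.13–13.14 (pp. 232–234)]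
[cite: RohrlichInventiones1984, Theorem (p. 409)] -/
theorem exists_kato_auxiliaryData_two (hfW : IsNewformOf W f) (h2N : ¬ 2 ∣ N) :
    ∃ (k : ℕ) (d d' : ℤ) (D : ℚ) (n : ZMod (2 ^ (k + 3)) → ℤ),
      0 < 2 ^ (k + 3) ∧ Int.gcd (5 : ℤ) (6 * 2 * (2 ^ (k + 3) : ℕ)) = 1 ∧ Int.gcd d (6 * 2 * N) = 1 ∧
      (d : ZMod (2 ^ (k + 3))) = 5 ∧ d * d' ≡ 1 [ZMOD ((2 ^ (k + 3) : ℕ) : ℤ)] ∧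
      (∀ j : ℕ, Int.gcd (5 * d) ((2 ^ j : ℕ) * (2 ^ (k + 3) : ℕ)) = 1) ∧
      D ≠ 0 ∧ (∀ a : ZMod (2 ^ (k + 3)), (n a : ℚ) = D * ratMinusSymbol f ((a.val : ℚ) / ((2 ^ (k + 3) : ℕ) : ℚ))) ∧
      ∀ (𝔭 : PrimeSpectrum (IwasawaAlgebra 2)), PowerSeries.C (2 : ℤ_[2]) ∉ 𝔭.asIdeal →
        ∀ (Ψc Ψd : IwasawaAlgebra 2) (aℓ εℓ : ℕ → ℤ) (Ψℓ : ℕ → IwasawaAlgebra 2), ∃ a : ZMod (2 ^ (k + 3)),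
          katoMultiplier 2 5 d (n a) (n (a * 5)) (n (a * d')) (n (a * 5 * d')) Ψc Ψd ∅ aℓ εℓ Ψℓ ∉ 𝔭.asIdeal := by
  obtain ⟨k, hk⟩ := exists_katoMultiplier_not_mem hfW h2N
  haveI : NeZero (2 ^ (k + 3)) := ⟨pow_ne_zero _ two_ne_zero⟩
  obtain ⟨d, d', hd5, hdg, hdd', hdd''⟩ := exists_int_five_mod_two_pow_coprime h2N (by omega : 1 ≤ k + 3)
  obtain ⟨D, n, hD, hn⟩ := exists_int_eq_mul_ratMinusSymbol f (2 ^ (k + 3))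
  refine ⟨k, d, d', D, n, pow_pos two_pos _, ?_, hdg, hd5, hdd', ?_, hD, hn, ?_⟩
  · -- `gcd(5, 12·2^{k+3}) = 1`
    have h : Int.gcd ((5 : ℕ) : ℤ) ((6 * 2 * 2 ^ (k + 3) : ℕ) : ℤ) = Nat.gcd 5 (6 * 2 * 2 ^ (k + 3)) :=
      Int.gcd_natCast_natCast 5 (6 * 2 * 2 ^ (k + 3))
    have hcop : Nat.Coprime 5 (6 * 2 * 2 ^ (k + 3)) :=
      Nat.Coprime.mul_right (by norm_num : Nat.Coprime 5 (6 * 2)) (Nat.Coprime.pow_right _ (by norm_num))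
    rw [Nat.coprime_iff_gcd_eq_one] at hcop
    rw [hcop] at h
    exact_mod_cast h
  · -- `gcd(5d, 2^j · 2^{k+3}) = 1`
    intro j
    have hd2 : IsCoprime d 2 := by
      have h12 : IsCoprime d ((6 * 2 * N : ℕ) : ℤ) := Int.isCoprime_iff_gcd_eq_one.mpr hdg
      have h' : ((6 * 2 * N : ℕ) : ℤ) = 2 * (6 * N) := by push_cast; ring
      rw [h'] at h12
      exact h12.of_mul_right_left
    have h52 : IsCoprime (5 : ℤ) 2 := by
      rw [Int.isCoprime_iff_gcd_eq_one]; decide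
    have h : IsCoprime (5 * d) (((2 ^ j : ℕ) : ℤ) * ((2 ^ (k + 3) : ℕ) : ℤ)) := by
      push_cast
      rw [← pow_add]
      exact (h52.mul_left hd2).pow_right
    exact Int.isCoprime_iff_gcd_eq_one.mp h
  · intro 𝔭 h2 Ψc Ψd aℓ εℓ Ψℓ
    have hc : ((5 : ℤ) : ZMod (2 ^ (k + 3))) = 5 := by norm_cast
    obtain ⟨a, ha⟩ := hk 𝔭 h2 5 d d' hc hd5 hdd'' D hD n hn Ψc Ψd aℓ εℓ Ψℓ
    refine ⟨a, ?_⟩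
    simpa only [Int.cast_ofNat] using ha

end Data

end Summit.BirchSwinnertonDyer.BirchSwinnertonDyer.Theorems.SignedKatoOffTwo.MultAvoid

end
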